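import Mathlib

/-!
# Route BarrierLever — item `KRSTNoGoBelow12cOnB05` (stmt-ValiantsHypothesis-19340), part 3/6:
# INITIAL FORMS — polynomials with algebraically independent linear parts are algebraically independent

Lean text authored by the cell planner seat `valiant-natproofs-p2` (gen 3, HOME/InitialForms-p2g3.lean =
HOME/RowZero-p2g3.lean v5 §F `Jac`, referee PASS), landed by the prover seat. Mathlib only. This is
the Jacobian criterion AT A POINT made elementary: translate constants away; the degree-scaling
algebra hom `scale : x_t ↦ ε x_t` into `S[ε]`, `S = F[x_τ]` (`scale g = Σ_d g_d ε^d`); an algebraic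
relation of the `f_k` of lowest `ε`-order `e` yields, after cancelling `ε^e` and setting `ε = 0`, a
relation among the degree-one components.

* `scale`, `scale_monomial`, `scale_eq_sum`, `scale_eq_X_mul`;
* **`algebraicIndependent_of_homogeneousComponent_one`** — if the `homogeneousComponent 1 (f k)` are
  algebraically independent then so are the `f k` (and the primed version for `f k` without
  constant term);
* `homogeneousComponent_one_prod_one_add_X` — the linear part of `Π_{i∈s} (1 + X_{w i})` is
  `Σ_{i∈s} X_{w i}`.

WHAT THIS IS NOT: not the general Jacobian criterion (no derivatives, no separability discussion).
-/

-- layout Summits/ValiantsHypothesis/ValiantsHypothesis forces the duplicated namespace component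
set_option linter.dupNamespace false

noncomputable section

open MvPolynomial Finset

namespace Summit.ValiantsHypothesis.ValiantsHypothesis.Theorems.BarrierLever.KRSTNoGoBelow12cOnB05.Jac

variable {F : Type*} [Field F] {τ : Type*}

/-! ### The degree-scaling hom `x_t ↦ ε x_t` into `S[ε]`, `S = F[x_τ]` -/

/-- `scale : x_t ↦ ε · x_t`, valued in `S[ε] = Polynomial (MvPolynomial τ F)`. -/
noncomputable def scale : MvPolynomial τ F →ₐ[F] Polynomial (MvPolynomial τ F) :=
  aeval fun t => Polynomial.C (X t) * Polynomial.X

/-- The degree of an exponent vector is the sum of its entries over its support. -/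
theorem degree_eq_support_sum (α : τ →₀ ℕ) : α.degree = ∑ i ∈ α.support, α i := rfl

/-- The scaling hom on a monomial: `x^α ↦ ε^{|α|} x^α`. -/
theorem scale_monomial (α : τ →₀ ℕ) (a : F) :
    scale (monomial α a) = Polynomial.C (monomial α a) * Polynomial.X ^ α.degree := by
  unfold scale
  rw [aeval_monomial, Finsupp.prod]
  simp_rw [mul_pow]
  rw [Finset.prod_mul_distrib, Finset.prod_pow_eq_pow_sum, ← degree_eq_support_sum, ← mul_assoc]
  congr 1
  rw [monomial_eq, map_mul, Polynomial.algebraMap_apply, algebraMap_eq, Finsupp.prod, map_prod]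
  congr 1
  refine Finset.prod_congr rfl fun i _ => ?_
  rw [map_pow]

/-- The scaling hom sorts a polynomial by degree: `scale g = Σ_d (g)_d ε^d`. -/
theorem scale_eq_sum (g : MvPolynomial τ F) :
    scale g = ∑ α ∈ g.support, Polynomial.C (monomial α (coeff α g)) * Polynomial.X ^ α.degree := by
  conv_lhs => rw [g.as_sum]
  rw [map_sum]
  exact Finset.sum_congr rfl fun α _ => scale_monomial α _

/-- If `g(0) = 0` then `scale g = ε · G` with `G(0) =` the linear part of `g`. -/
theorem scale_eq_X_mul (g : MvPolynomial τ F) (h0 : coeff 0 g = 0) :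
    ∃ G : Polynomial (MvPolynomial τ F), scale g = Polynomial.X * G ∧
      G.eval 0 = homogeneousComponent 1 g := by
  classical
  have hpos : ∀ α ∈ g.support, 1 ≤ α.degree := by
    intro α hα
    rw [Nat.one_le_iff_ne_zero, Ne, Finsupp.degree_eq_zero_iff]
    rintro rfl
    exact (mem_support_iff.mp hα) h0
  refine ⟨∑ α ∈ g.support, Polynomial.C (monomial α (coeff α g)) * Polynomial.X ^ (α.degree - 1), ?_, ?_⟩
  · rw [scale_eq_sum g, Finset.mul_sum]
    refine Finset.sum_congr rfl fun α hα => ?_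
    rw [mul_left_comm, ← pow_succ', Nat.sub_add_cancel (hpos α hα)]
  · rw [Polynomial.eval_finsetSum, homogeneousComponent_apply, Finset.sum_filter]
    refine Finset.sum_congr rfl fun α hα => ?_
    rw [Polynomial.eval_mul_X_pow, Polynomial.eval_C]
    by_cases h1 : α.degree = 1
    · rw [if_pos h1, h1, Nat.sub_self, pow_zero, mul_one]
    · rw [if_neg h1, zero_pow (by have := hpos α hα; omega), mul_zero]

/-- Homogeneous polynomials scale: `P(u·G) = u^d · P(G)`. -/
theorem aeval_mul_eq_pow_mul {ι A : Type*} [CommRing A] [Algebra F A] (u : A) (G : ι → A)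
    {P : MvPolynomial ι F} {d : ℕ} (hP : P.IsHomogeneous d) :
    aeval (fun k => u * G k) P = u ^ d * aeval G P := by
  conv_lhs => rw [P.as_sum]
  conv_rhs => rw [P.as_sum]
  rw [map_sum, map_sum, Finset.mul_sum]
  refine Finset.sum_congr rfl fun α hα => ?_
  have hdeg : α.degree = d := by
    by_contra hne
    exact (mem_support_iff.mp hα) (hP.coeff_eq_zero hne)
  rw [aeval_monomial, aeval_monomial, Finsupp.prod, Finsupp.prod]
  simp_rw [mul_pow]
  rw [Finset.prod_mul_distrib, Finset.prod_pow_eq_pow_sum, ← degree_eq_support_sum, hdeg]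
  ring

/-- **Initial-form criterion (zero constant terms).** If `g_k(0) = 0` for all `k` and the linear parts
`(g_k)_1` are algebraically independent (e.g. linearly independent linear forms), then the `g_k` are
algebraically independent. -/
theorem algebraicIndependent_of_homogeneousComponent_one' {ι : Type*} (g : ι → MvPolynomial τ F)
    (h0 : ∀ k, coeff 0 (g k) = 0)
    (h1 : AlgebraicIndependent F fun k => homogeneousComponent 1 (g k)) :
    AlgebraicIndependent F g := by
  classical
  choose G hG hG0 using fun k => scale_eq_X_mul (g k) (h0 k)
  rw [algebraicIndependent_iff]
  intro D hD
  by_contra hne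
  have hex : ∃ d, homogeneousComponent d D ≠ 0 := by
    by_contra hall
    apply hne
    rw [← sum_homogeneousComponent D]
    exact Finset.sum_eq_zero fun d _ => not_not.mp fun h => hall ⟨d, h⟩
  set e := Nat.find hex with he_def
  have he : homogeneousComponent e D ≠ 0 := Nat.find_spec hex
  have hlt : ∀ d < e, homogeneousComponent d D = 0 := fun d hd => by
    by_contra h
    exact Nat.find_min hex hd h
  have heN : e ≤ D.totalDegree := by
    by_contra h
    exact he (homogeneousComponent_eq_zero _ _ (not_le.mp h))
  set N := D.totalDegree with hN
  -- apply `scale` to the relation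
  have hA : ∀ d, aeval (fun k => scale (g k)) (homogeneousComponent d D) =
      Polynomial.X ^ d * aeval G (homogeneousComponent d D) := fun d => by
    have : (fun k => scale (g k)) = fun k => Polynomial.X * G k := funext hG
    rw [this]
    exact aeval_mul_eq_pow_mul _ _ (homogeneousComponent_isHomogeneous d D)
  have hsum : ∑ d ∈ Finset.range (N + 1), Polynomial.X ^ d * aeval G (homogeneousComponent d D) = 0 := by
    have h := congrArg scale hD
    rw [map_zero, comp_aeval_apply] at h
    have h2 : aeval (fun k => scale (g k)) (∑ d ∈ Finset.range (N + 1), homogeneousComponent d D) = 0 := by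
      rwa [sum_homogeneousComponent]
    rw [map_sum] at h2
    rw [← h2]
    exact Finset.sum_congr rfl fun d _ => (hA d).symm
  -- factor out `ε^e`
  have hsum' : ∑ d ∈ Finset.range (N + 1), Polynomial.X ^ d * aeval G (homogeneousComponent d D) =
      Polynomial.X ^ e * ∑ d ∈ Finset.range (N + 1),
        (if e ≤ d then Polynomial.X ^ (d - e) * aeval G (homogeneousComponent d D) else 0) := by
    rw [Finset.mul_sum]
    refine Finset.sum_congr rfl fun d _ => ?_
    by_cases hd : e ≤ d
    · rw [if_pos hd, ← mul_assoc, ← pow_add, Nat.add_sub_cancel' hd]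
    · rw [if_neg hd, mul_zero, hlt d (by omega), map_zero, mul_zero]
  have hB : ∑ d ∈ Finset.range (N + 1),
      (if e ≤ d then Polynomial.X ^ (d - e) * aeval G (homogeneousComponent d D) else 0) = 0 := by
    rw [hsum'] at hsum
    rcases mul_eq_zero.mp hsum with h | h
    · exact absurd h (pow_ne_zero _ Polynomial.X_ne_zero)
    · exact h
  -- set `ε = 0`
  have hC := congrArg (Polynomial.eval 0) hB
  rw [Polynomial.eval_finsetSum, Polynomial.eval_zero, Finset.sum_eq_single e] at hC
  · rw [if_pos le_rfl, Nat.sub_self, pow_zero, one_mul] at hC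
    have hev : Polynomial.eval 0 (aeval G (homogeneousComponent e D)) =
        aeval (fun k => homogeneousComponent 1 (g k)) (homogeneousComponent e D) := by
      have : Polynomial.eval 0 (aeval G (homogeneousComponent e D)) =
          ((Polynomial.aeval (0 : MvPolynomial τ F)).restrictScalars F)
            (aeval G (homogeneousComponent e D)) := by
        rw [AlgHom.restrictScalars_apply, Polynomial.coe_aeval_eq_eval]
      have hfun : (fun i => ((Polynomial.aeval (0 : MvPolynomial τ F)).restrictScalars F) (G i)) =
          fun k => homogeneousComponent 1 (g k) := by
        funext k
        rw [AlgHom.restrictScalars_apply, Polynomial.coe_aeval_eq_eval, hG0]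
      rw [this, comp_aeval_apply, hfun]
    rw [hev] at hC
    exact he (h1.eq_zero_of_aeval_eq_zero _ hC)
  · intro d _ hde
    by_cases hed : e ≤ d
    · rw [if_pos hed, Polynomial.eval_mul, Polynomial.eval_pow, Polynomial.eval_X,
        zero_pow (by omega : d - e ≠ 0), zero_mul]
    · rw [if_neg hed, Polynomial.eval_zero]
  · intro h
    exact absurd (Finset.mem_range.mpr (by omega)) h

/-- **Initial-form criterion.** If the degree-1 homogeneous components of the `f_k` are algebraically
independent, so are the `f_k` (translate the constants away, then the primed version). -/
theorem algebraicIndependent_of_homogeneousComponent_one {ι : Type*} (f : ι → MvPolynomial τ F)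
    (h1 : AlgebraicIndependent F fun k => homogeneousComponent 1 (f k)) : AlgebraicIndependent F f := by
  set c : ι → F := fun k => coeff 0 (f k) with hc
  have hg : AlgebraicIndependent F fun k => f k - C (c k) := by
    apply algebraicIndependent_of_homogeneousComponent_one'
    · intro k
      rw [coeff_sub, coeff_zero_C, hc, sub_self]
    · have : (fun k => homogeneousComponent 1 (f k - C (c k))) = fun k => homogeneousComponent 1 (f k) := by
        funext k
        rw [map_sub, homogeneousComponent_eq_zero 1 (C (c k)) (by rw [totalDegree_C]; exact one_pos),
          sub_zero]
      rw [this]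
      exact h1
  rw [algebraicIndependent_iff] at hg ⊢
  intro D hD
  have key : aeval (fun k => f k - C (c k))
      (aeval (fun k => (X k + C (c k) : MvPolynomial ι F)) D) = aeval f D := by
    have hfun : (fun i => aeval (fun k => f k - C (c k)) (X i + C (c i) : MvPolynomial ι F)) = f := by
      funext k
      rw [map_add, aeval_X, aeval_C, algebraMap_eq, sub_add_cancel]
    rw [comp_aeval_apply, hfun]
  have h2 := hg _ (by rw [key]; exact hD)
  have back : aeval (fun k => (X k - C (c k) : MvPolynomial ι F))
      (aeval (fun k => (X k + C (c k) : MvPolynomial ι F)) D) = D := by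
    rw [comp_aeval_apply]
    have : (fun k => aeval (fun k => (X k - C (c k) : MvPolynomial ι F)) (X k + C (c k))) = X := by
      funext k
      rw [map_add, aeval_X, aeval_C, algebraMap_eq, sub_add_cancel]
    rw [this, aeval_X_left_apply]
  rw [h2, map_zero] at back
  exact back.symm

/-! ### The linear part of `Π (1 + X_{w i})` -/

/-- The linear part of `Π_{i ∈ s} (1 + X_{w i})` is `Σ_{i ∈ s} X_{w i}`. -/
theorem homogeneousComponent_one_prod_one_add_X {κ : Type*} (s : Finset κ) (w : κ → τ) :
    homogeneousComponent 1 (∏ i ∈ s, (1 + X (w i) : MvPolynomial τ F)) = ∑ i ∈ s, X (w i) := by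
  classical
  rw [Finset.prod_one_add, map_sum]
  have hT : ∀ T ∈ s.powerset, homogeneousComponent 1 (∏ i ∈ T, (X (w i) : MvPolynomial τ F)) =
      if T.card = 1 then ∏ i ∈ T, (X (w i) : MvPolynomial τ F) else 0 := by
    intro T _
    have hhom : (∏ i ∈ T, (X (w i) : MvPolynomial τ F)).IsHomogeneous T.card := by
      have := IsHomogeneous.prod T (fun i => (X (w i) : MvPolynomial τ F)) (fun _ => 1)
        (fun i _ => isHomogeneous_X F (w i))
      rwa [← Finset.card_eq_sum_ones] at this
    rw [homogeneousComponent_of_mem ((mem_homogeneousSubmodule _ _).mpr hhom)]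
    by_cases h : T.card = 1
    · rw [if_pos h, if_pos h.symm]
    · rw [if_neg h, if_neg (Ne.symm h)]
  rw [Finset.sum_congr rfl hT, ← Finset.sum_filter, ← Finset.powersetCard_eq_filter,
    Finset.powersetCard_one, Finset.sum_map]
  refine Finset.sum_congr rfl fun i _ => ?_
  exact Finset.prod_singleton _ _


end Summit.ValiantsHypothesis.ValiantsHypothesis.Theorems.BarrierLever.KRSTNoGoBelow12cOnB05.Jac

end
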